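import Summits.BirchSwinnertonDyer.BirchSwinnertonDyer.Theorems.CongruentShaFreeCutFanWanRoad

/-! # Route `CongruentShaFreeCut` (rung S2) — registered stub `stub_descentFromGaussianField` of crux
`RankPosOfTwoSelmerCorankOne` (stmt-BirchSwinnertonDyer-19079, the route's declared RESIDUAL conjunct),
line `fw-ramified-tower` (skeleton f37e982047249591, registered 2026-08-26T03:36:27Z)

STUB CREDIT ALIAS (3 lines). The registered stub is the descent `ℚ(i) → ℚ` of the line: for every
`n ≠ 0` and every number field `K` with `[K : ℚ] = 2`, `d_K = −4` (i.e. `K ≅ ℚ(i)`, the CM field of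
`E_n : y² = x³ − n²x`), a point of infinite order in `E_n(K)` yields one in `E_n(ℚ)`. It is the `←`
direction of the tree theorem
`CongruentShaFreeCutFanWanRoad.one_le_mordellWeilRank_iff_baseChange_gaussianField` (p418721, prover
bsd-cn100-transfer-2): `rank E_n(K) = rank E_n(ℚ) + rank E_n^{(−4)}(ℚ)` (Silverman AEC Ex. 10.16,
tree theorem `mordellWeilRank_baseChange_quadratic_holds`), `E_n^{(−4)} = E_{4n}` as Weierstrass models
and `E_{4n} ≅ E_n` over `ℚ`, so `rank E_n(K) = 2 · rank E_n(ℚ)`. This file restates it under the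
REGISTERED stub name with the registered signature (token for token), so that the landing is recorded
as a proved stub of the crux's skeleton. Nothing new is asserted; the load-bearing stub of the line,
`stub_fwGaussianPoint` (corank₂ = 1 ⟹ a `ℚ(i)`-point of infinite order; Fan–Wan v2's mechanism at the
ramified prime `2`), stays OPEN and research-grade. PARTITION: none (RANK axis). -/

namespace Summit.BirchSwinnertonDyer.BirchSwinnertonDyer.Theorems.CongruentShaFreeCutDescentFromGaussianFieldStub

open Literature.NumberTheory.EllipticCurves

/-- **stub_descentFromGaussianField** (size S, LANDED form; line `fw-ramified-tower` of crux A =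
`RankPosOfTwoSelmerCorankOne`): for every `n ≠ 0` and every number field `K` with `[K : ℚ] = 2` and
`d_K = −4`, `1 ≤ rank E_n(K) ⟹ 1 ≤ rank E_n(ℚ)`. Proof: the `←` direction of
`CongruentShaFreeCutFanWanRoad.one_le_mordellWeilRank_iff_baseChange_gaussianField`
(`rank E_n(ℚ(i)) = 2 · rank E_n(ℚ)`). [cite: SilvermanAEC2009, Exercise 10.16] -/
theorem stub_descentFromGaussianField :
    ∀ ⦃n : ℕ⦄, n ≠ 0 → ∀ (K : Type) [Field K] [NumberField K], Module.finrank ℚ K = 2 →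
      NumberField.discr K = -4 → 1 ≤ ((congruentNumberCurve n).baseChange K).mordellWeilRank →
        1 ≤ (congruentNumberCurve n).mordellWeilRank :=
  fun _ hn K _ _ hK hd h =>
    (CongruentShaFreeCutFanWanRoad.one_le_mordellWeilRank_iff_baseChange_gaussianField hn K hK hd).2 h

end Summit.BirchSwinnertonDyer.BirchSwinnertonDyer.Theorems.CongruentShaFreeCutDescentFromGaussianFieldStub
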